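import Summits.QuantumFields.YangMills.Theorems.LuscherReductionOneSiteLevelsKacDefs
import Summits.QuantumFields.YangMills.Theorems.LuscherReductionOneSiteLevelsGnForms
import Summits.QuantumFields.YangMills.Theorems.LuscherReductionOneSiteLevelsNormaliser
import Summits.QuantumFields.YangMills.Theorems.FemtoTransferGapRungW1up

/-!
# INNER, layer II (flattening, part 1): mass and magnetic term through the gnomonic chart —
# `∫ g² = 8∫ρG² ≤ 8ρ₀∫G²`, `∫ B·S·g² ≥ 8ρ₀ t (1 − 8μ²R₀²) ∫ V G²`; the restricted flat jump form `flatJumpBall`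

Support module of crux `OneSiteLevels` (route `LuscherReduction`, item stmt-QuantumFields-20007; STUB-PLAN
`Cruxes/OneSiteLevels/STUB-PLAN-stub_absUpperInnerAL1.md` §2.2 items II.2 and II.4 (lattice half), owner ruling INNER-RULING-g16),
fleet seat ym-luscher-20007-p2 (LATTICE lane).  Everything here is proved, AL1-free.

Setting: heat time `t > 0`, coupling `B = 2/t³` (so `t = λ_b(B)`), chart scale `μ = t/2` (so `Bμ² = 1/(2t)`, `8Bμ⁴ = t`,
`μ √(2πt) = √(π/B)`), `ρ₀ = μ⁹ (2π²)⁻³` the maximum of the chart density `ρ = gnDensityReal μ`.  A lattice function `g : Cfg → ℝ` is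
CHART-REPRESENTED by `G : ZM → ℝ` when `g (gnChart μ σ y) = G y` for all eight patterns `σ` (physical data are: `…KacChart`).
* §1 `flatJumpBall t R G = (2t)⁻¹ ∫∫_{‖y‖,‖y′‖ ≤ R} p_t(y,y′) (G y − G y′)²` — the flat jump form RESTRICTED to a ball pair (the part of
  `flatJump` a kernel minorant can see); unit algebra at `μ = t/2`, `B = 2/t³`.
* §2 `integral_eq_of_chartRep` (II.2): `∫ h dU = 8 ∫ ρ H` for chart-represented bounded measurable `h`; `∫ g² ≤ 8ρ₀ ∫ G²`.
* §3 `integral_action_mul_sq_ge` (II.4, magnetic half): `∫ B·S·g² ≥ 8ρ₀ · t · (1 − 8μ²R₀²) ∫ V G²` when `G` lives in `‖y‖ ≤ R₀`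
  (`S(chart) = 8·gnPot`, `gnPot ≥ μ⁴(1 − μ²‖y‖²)² V`, `ρ ≥ ρ₀(1 − 6μ²‖y‖²)`).
* (companion file `…KacFlattenJump`: the kinetic half `latticeJump B g ≥ 8ρ₀ · t · (1 − 6μ²R²)² · flatJumpBall t R G`.)

## WHAT THIS IS NOT
Not the INNER stub: the Gaussian tail (`flatJump ≤ flatJumpBall + tail`) and the assembly with `FlatKacFormBound` are the companion
files.  Femto rung R2b1 vocabulary; NOT an infinite-volume ∕ Clay gap statement.
-/

set_option autoImplicit false

noncomputable section

open MeasureTheory Filter Topology Real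
open scoped ENNReal
open Literature.MathematicalPhysics.QuantumFieldTheory
open Literature.MathematicalPhysics.QuantumLattice
open Literature.Analysis.OperatorTheory.YMMatrixModel

namespace Summit.QuantumFields.YangMills.Theorems.FemtoTransferGap

/-! ### §1. The restricted flat jump form and the unit algebra -/

/-- Indicator of the closed ball `‖y‖ ≤ R` of the zero-mode space. [folklore] -/
def ballInd (R : ℝ) (y : ZM) : ℝ := if ‖y‖ ≤ R then 1 else 0

/-- `ballInd R y ∈ {0, 1}`, hence in `[0, 1]`. [folklore] -/
theorem ballInd_nonneg (R : ℝ) (y : ZM) : 0 ≤ ballInd R y := by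
  unfold ballInd; split_ifs <;> norm_num

/-- `ballInd R y ≤ 1`. [folklore] -/
theorem ballInd_le_one (R : ℝ) (y : ZM) : ballInd R y ≤ 1 := by
  unfold ballInd; split_ifs <;> norm_num

/-- `ballInd` is measurable. [folklore] -/
theorem measurable_ballInd (R : ℝ) : Measurable (ballInd R) := by
  unfold ballInd
  exact Measurable.ite (measurableSet_le continuous_norm.measurable measurable_const) measurable_const measurable_const

/-- `x^{−9/2} = (√x ⁹)⁻¹` for `x ≥ 0`. [folklore] -/
theorem rpow_neg_nine_half {x : ℝ} (hx : 0 ≤ x) : x ^ (-(9 : ℝ) / 2) = (Real.sqrt x ^ 9)⁻¹ := by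
  rw [Real.sqrt_eq_rpow, ← Real.rpow_natCast, ← Real.rpow_mul hx, ← Real.rpow_neg hx]
  norm_num

/-- The heat kernel with the Gaussian constant written as `(√(2πt) ⁹)⁻¹`. [folklore] -/
theorem heatKernel_eq {t : ℝ} (ht : 0 < t) (x y : ZM) :
    heatKernel t x y = (Real.sqrt (2 * π * t) ^ 9)⁻¹ * Real.exp (-‖x - y‖ ^ 2 / (2 * t)) := by
  rw [heatKernel, rpow_neg_nine_half (by positivity)]

/-- `0 ≤ p_t` (`t > 0`). [folklore] -/
theorem heatKernel_nonneg {t : ℝ} (ht : 0 < t) (x y : ZM) : 0 ≤ heatKernel t x y := by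
  rw [heatKernel_eq ht]; positivity

/-- **The flat jump form restricted to a ball pair**: `flatJumpBall t R G = (2t)⁻¹ ∫∫ 1_{‖y‖≤R} 1_{‖y′‖≤R} p_t(y,y′) (G y − G y′)²`
(product Lebesgue measure on `ZM × ZM`). [cite: LiebYau1988, (2.9)–(2.11)] -/
def flatJumpBall (t R : ℝ) (G : ZM → ℝ) : ℝ :=
  1 / (2 * t) * ∫ q : ZM × ZM, ballInd R q.1 * ballInd R q.2 * (heatKernel t q.1 q.2 * (G q.1 - G q.2) ^ 2)
    ∂((volume : Measure ZM).prod volume)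

/-- The integrand of `flatJumpBall` is nonnegative (`t > 0`). [folklore] -/
theorem flatJumpBall_integrand_nonneg {t : ℝ} (ht : 0 < t) (R : ℝ) (G : ZM → ℝ) (q : ZM × ZM) :
    0 ≤ ballInd R q.1 * ballInd R q.2 * (heatKernel t q.1 q.2 * (G q.1 - G q.2) ^ 2) := by
  have h1 := ballInd_nonneg R q.1; have h2 := ballInd_nonneg R q.2
  have h3 : 0 ≤ heatKernel t q.1 q.2 := heatKernel_nonneg ht q.1 q.2
  positivity

/-- `flatJumpBall ≥ 0` (`t > 0`). [folklore] -/
theorem flatJumpBall_nonneg {t : ℝ} (ht : 0 < t) (R : ℝ) (G : ZM → ℝ) : 0 ≤ flatJumpBall t R G := by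
  unfold flatJumpBall
  exact mul_nonneg (by positivity) (integral_nonneg fun q => flatJumpBall_integrand_nonneg ht R G q)

/-- Unit algebra at `μ = t/2`, `B = 2/t³`: `B μ² = 1/(2t)`. [folklore] -/
theorem coupling_mul_sq_half {t : ℝ} (ht : 0 < t) : 2 / t ^ 3 * (t / 2) ^ 2 = 1 / (2 * t) := by
  field_simp

/-- Unit algebra: `8 B μ⁴ = t`. [folklore] -/
theorem eight_mul_coupling_mul_pow_four_half {t : ℝ} (ht : 0 < t) : 8 * (2 / t ^ 3) * (t / 2) ^ 4 = t := by
  field_simp; ring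

/-- Unit algebra: `μ √(2πt) = √(π/B)`. [folklore] -/
theorem half_mul_sqrt_eq {t : ℝ} (ht : 0 < t) : t / 2 * Real.sqrt (2 * π * t) = Real.sqrt (π / (2 / t ^ 3)) := by
  have hπ := Real.pi_pos
  have e : π / (2 / t ^ 3) = (t / 2) ^ 2 * (2 * π * t) := by field_simp
  rw [e, Real.sqrt_mul (sq_nonneg _), Real.sqrt_sq (by positivity)]

/-! ### §2. Integrals of chart-represented functions (II.2) -/

section ChartRep

variable {μ : ℝ}

/-- **`∫ h dU = 8 ∫ ρ H`** for a bounded measurable `h` that is chart-represented by `H`. [folklore] -/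
theorem integral_eq_of_chartRep (hμ : 0 < μ) {h : Cfg → ℝ} (hm : Measurable h) (hb : ∃ C : ℝ, ∀ U, |h U| ≤ C)
    {H : ZM → ℝ} (hrep : ∀ σ y, h (gnChart μ σ y) = H y) :
    ∫ U, h U ∂cfgMeasure = 8 * ∫ y, gnDensityReal μ y * H y := by
  rw [show cfgMeasure = configMeasure SU2 1 from rfl, integral_configMeasure_eq_sum_gnChart hμ hm hb]
  simp only [hrep]
  rw [Finset.sum_const, Finset.card_univ, Fintype.card_fun, Fintype.card_bool, Fintype.card_fin, nsmul_eq_mul]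
  norm_num

/-- A bounded measurable function supported in a ball of `ZM` is integrable. [folklore] -/
theorem integrable_of_bounded_of_support {G : ZM → ℝ} (hG : Measurable G) {M : ℝ} (hM : ∀ y, |G y| ≤ M) {R : ℝ}
    (hsupp : ∀ y, G y ≠ 0 → ‖y‖ ≤ R) : Integrable G := by
  have hs : MeasurableSet (Metric.closedBall (0 : ZM) R) := Metric.isClosed_closedBall.measurableSet
  have hGi : G = (Metric.closedBall (0 : ZM) R).indicator G := by
    funext y
    by_cases hy : y ∈ Metric.closedBall (0 : ZM) R
    · rw [Set.indicator_of_mem hy]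
    · rw [Set.indicator_of_notMem hy]
      by_contra h
      exact hy (by rw [Metric.mem_closedBall, dist_zero_right]; exact hsupp y h)
  rw [hGi, integrable_indicator_iff hs]
  exact Measure.integrableOn_of_bounded (M := M) (measure_closedBall_lt_top.ne) hG.aestronglyMeasurable
    (ae_of_all _ fun y => by rw [Real.norm_eq_abs]; exact hM y)

/-- The square of a bounded measurable function supported in a ball is integrable. [folklore] -/
theorem integrable_sq_of_bounded_of_support {G : ZM → ℝ} (hG : Measurable G) {M : ℝ} (hM : ∀ y, |G y| ≤ M) {R : ℝ}
    (hsupp : ∀ y, G y ≠ 0 → ‖y‖ ≤ R) : Integrable fun y => G y ^ 2 :=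
  integrable_of_bounded_of_support (hG.pow_const 2) (M := M ^ 2)
    (fun y => by rw [abs_pow]; exact pow_le_pow_left₀ (abs_nonneg _) (hM y) 2)
    (fun y hy => hsupp y (by intro h; exact hy (by rw [h]; ring)))

/-- **II.2 (mass)**: `∫ g² dU ≤ 8 ρ₀ ∫ G²` for a bounded measurable `g` chart-represented by `G` with `G²` integrable. [folklore] -/
theorem integral_sq_le_of_chartRep (hμ : 0 < μ) {g : Cfg → ℝ} (hgm : Measurable g) (hgb : ∃ C : ℝ, ∀ U, |g U| ≤ C)
    {G : ZM → ℝ} (hrep : ∀ σ y, g (gnChart μ σ y) = G y) (hGi : Integrable fun y => G y ^ 2) :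
    ∫ U, g U ^ 2 ∂cfgMeasure ≤ 8 * (μ ^ 9 * ((2 * π ^ 2)⁻¹) ^ 3) * ∫ y, G y ^ 2 := by
  obtain ⟨C, hC⟩ := hgb
  have hrep2 : ∀ σ y, (fun U => g U ^ 2) (gnChart μ σ y) = G y ^ 2 := fun σ y => by simp only [hrep]
  rw [integral_eq_of_chartRep hμ (hgm.pow_const 2) ⟨C ^ 2, fun U => by
    rw [abs_pow]; exact pow_le_pow_left₀ (abs_nonneg _) (hC U) 2⟩ hrep2]
  have h : ∫ y, gnDensityReal μ y * G y ^ 2 ≤ ∫ y, μ ^ 9 * ((2 * π ^ 2)⁻¹) ^ 3 * G y ^ 2 :=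
    integral_mono_of_nonneg (ae_of_all _ fun y => mul_nonneg (gnDensityReal_pos hμ y).le (sq_nonneg _)) (hGi.const_mul _)
      (ae_of_all _ fun y => mul_le_mul_of_nonneg_right (gnDensityReal_le hμ y) (sq_nonneg _))
  rw [integral_const_mul] at h
  linarith

end ChartRep

/-! ### §3. The magnetic term (II.4, potential half) -/

section Magnetic

variable {μ : ℝ}

/-- **`gnPot μ y ≥ μ⁴ (1 − μ²‖y‖²)² V(y)`** when `μ²‖y‖² ≤ 1` (`c_i ≥ 1 − μ²|y_i|² ≥ 1 − μ²‖y‖² ≥ 0`). [folklore] -/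
theorem gnPot_ge (μ : ℝ) {y : ZM} (hy : μ ^ 2 * ‖y‖ ^ 2 ≤ 1) :
    μ ^ 4 * (1 - μ ^ 2 * ‖y‖ ^ 2) ^ 2 * luscherPotential y ≤ gnPot μ y := by
  have hcsq : ∀ i, csq i y ≤ ‖y‖ ^ 2 := fun i => csq_le_norm_sq y i
  have hc : ∀ i, 1 - μ ^ 2 * ‖y‖ ^ 2 ≤ gnC μ y i := fun i =>
    le_trans (by nlinarith [hcsq i, sq_nonneg μ]) (one_sub_le_gnC μ y i)
  have h0 : 0 ≤ 1 - μ ^ 2 * ‖y‖ ^ 2 := by linarith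
  rw [gnPot, luscherPotential_eq_sum_crossSq]
  have key : ∑ i : Fin 3, ∑ j : Fin 3, μ ^ 4 * (1 - μ ^ 2 * ‖y‖ ^ 2) ^ 2 * crossSq i j y ≤
      ∑ i : Fin 3, ∑ j : Fin 3, μ ^ 4 * (gnC μ y i * gnC μ y j) * crossSq i j y := by
    refine Finset.sum_le_sum fun i _ => Finset.sum_le_sum fun j _ => ?_
    have hij : (1 - μ ^ 2 * ‖y‖ ^ 2) ^ 2 ≤ gnC μ y i * gnC μ y j := by
      rw [sq]; exact mul_le_mul (hc i) (hc j) h0 (gnC_pos μ y i).le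
    exact mul_le_mul_of_nonneg_right (mul_le_mul_of_nonneg_left hij (by positivity)) (crossSq_nonneg i j y)
  have e : μ ^ 4 * (1 - μ ^ 2 * ‖y‖ ^ 2) ^ 2 * ((1 / 4 : ℝ) * ∑ i : Fin 3, ∑ j : Fin 3, crossSq i j y) =
      (1 / 4 : ℝ) * ∑ i : Fin 3, ∑ j : Fin 3, μ ^ 4 * (1 - μ ^ 2 * ‖y‖ ^ 2) ^ 2 * crossSq i j y := by
    rw [mul_left_comm]
    congr 1
    rw [Finset.mul_sum]
    exact Finset.sum_congr rfl fun i _ => by rw [Finset.mul_sum]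
  rw [e]
  exact mul_le_mul_of_nonneg_left key (by norm_num)

/-- Elementary: `(1 − 6a)(1 − a)² ≥ 1 − 8a` for `a ≤ 1/6` (the difference is `a²(13 − 6a)`). [folklore] -/
theorem one_sub_eight_mul_le {a : ℝ} (ha6 : 6 * a ≤ 1) : 1 - 8 * a ≤ (1 - 6 * a) * (1 - a) ^ 2 := by
  nlinarith [mul_nonneg (sq_nonneg a) (by linarith : (0 : ℝ) ≤ 13 - 6 * a)]

/-- The Wilson action of the one-site lattice is bounded. [folklore] -/
theorem wilsonAction_su2_le (U : Cfg) : wilsonAction su2Rep U ≤ (Fintype.card (Plaquette 3 1) : ℝ) * (2 * 2 ^ 2 * 2 ^ 2) := by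
  refine wilsonAction_le_of_vacDist U (t := 2) fun e => ?_
  have h1 := vacDist_le_sub_one (U e)
  have h2 := vacDist_le_add_one (U e)
  have e1 := frobNorm_sub_one_sq_eq_scalarPart (U e)
  have e2 := frobNorm_add_one_sq_eq_scalarPart (U e)
  have h3 := abs_scalarPart_le (U e)
  rw [abs_le] at h3
  have hv := vacDist_nonneg (U e)
  have hn1 := frobNorm_nonneg ((U e : Matrix (Fin 2) (Fin 2) ℂ) - 1)
  have hn2 := frobNorm_nonneg ((U e : Matrix (Fin 2) (Fin 2) ℂ) + 1)
  rcases le_or_gt 0 (scalarPart (U e)) with hs | hs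
  · have : frobNorm ((U e : Matrix (Fin 2) (Fin 2) ℂ) - 1) ≤ 2 := by nlinarith
    linarith
  · have : frobNorm ((U e : Matrix (Fin 2) (Fin 2) ℂ) + 1) ≤ 2 := by nlinarith
    linarith

/-- **II.4, potential half**: for `B ≥ 0`, `μ > 0`, a bounded measurable `g` chart-represented (at scale `μ`) by `G`, `G` supported in
`‖y‖ ≤ R₀` with `6μ²R₀² ≤ 1`, and `V·G²` integrable:
`8 ρ₀ · (8Bμ⁴) · (1 − 8μ²R₀²) ∫ V G² ≤ ∫ B · S · g² dU` (`S(gnChart μ σ y) = 8 gnPot μ y ≥ 8μ⁴(1 − μ²R₀²)² V(y)`,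
`ρ ≥ ρ₀(1 − 6μ²R₀²)` on the support). [cite: Luscher1983, §2] -/
theorem integral_action_mul_sq_ge {B : ℝ} (hB : 0 ≤ B) (hμ : 0 < μ) {g : Cfg → ℝ} (hgm : Measurable g)
    (hgb : ∃ C : ℝ, ∀ U, |g U| ≤ C) {G : ZM → ℝ} (hrep : ∀ σ y, g (gnChart μ σ y) = G y)
    {R₀ : ℝ} (hsupp : ∀ y, G y ≠ 0 → ‖y‖ ≤ R₀) (hwin : 6 * (μ ^ 2 * R₀ ^ 2) ≤ 1)
    (hVi : Integrable fun y => luscherPotential y * G y ^ 2) :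
    8 * (μ ^ 9 * ((2 * π ^ 2)⁻¹) ^ 3) * (8 * B * μ ^ 4) * (1 - 8 * (μ ^ 2 * R₀ ^ 2)) * ∫ y, luscherPotential y * G y ^ 2 ≤
      ∫ U, B * wilsonAction su2Rep U * g U ^ 2 ∂cfgMeasure := by
  obtain ⟨C, hC⟩ := hgb
  haveI := secondCountableTopology_su2
  have hSm : Measurable fun U : Cfg => wilsonAction su2Rep U := (continuous_wilsonAction su2Rep continuous_su2Rep).measurable
  set Smax : ℝ := (Fintype.card (Plaquette 3 1) : ℝ) * (2 * 2 ^ 2 * 2 ^ 2) with hSmax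
  -- the lattice integral through the chart
  have hm : Measurable fun U : Cfg => B * wilsonAction su2Rep U * g U ^ 2 := (measurable_const.mul hSm).mul (hgm.pow_const 2)
  have hb : ∃ C' : ℝ, ∀ U : Cfg, |B * wilsonAction su2Rep U * g U ^ 2| ≤ C' := by
    refine ⟨B * Smax * C ^ 2, fun U => ?_⟩
    rw [abs_mul, abs_mul, abs_of_nonneg hB, abs_of_nonneg (wilsonAction_su2_nonneg U), abs_pow]
    exact mul_le_mul (mul_le_mul_of_nonneg_left (wilsonAction_su2_le U) hB) (pow_le_pow_left₀ (abs_nonneg _) (hC U) 2)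
      (by positivity) (by positivity)
  have hrep' : ∀ σ y, (fun U : Cfg => B * wilsonAction su2Rep U * g U ^ 2) (gnChart μ σ y) = B * (8 * gnPot μ y) * G y ^ 2 := by
    intro σ y; simp only [wilsonAction_gnChart, hrep]
  rw [integral_eq_of_chartRep hμ hm hb hrep']
  -- pointwise minorant on the flat side
  set ρ₀ : ℝ := μ ^ 9 * ((2 * π ^ 2)⁻¹) ^ 3 with hρ₀
  set a : ℝ := μ ^ 2 * R₀ ^ 2 with ha
  have ha0 : 0 ≤ a := by positivity
  have hpt : ∀ y, ρ₀ * (8 * B * μ ^ 4) * (1 - 8 * a) * (luscherPotential y * G y ^ 2) ≤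
      gnDensityReal μ y * (B * (8 * gnPot μ y) * G y ^ 2) := by
    intro y
    by_cases hy : G y = 0
    · rw [hy]; simp
    have hyR := hsupp y hy
    have hy2 : μ ^ 2 * ‖y‖ ^ 2 ≤ a := by
      rw [ha]; exact mul_le_mul_of_nonneg_left (pow_le_pow_left₀ (norm_nonneg _) hyR 2) (sq_nonneg _)
    have hρ : ρ₀ * (1 - 6 * a) ≤ gnDensityReal μ y := gnDensityReal_ge_of_norm_le hμ hyR
    have hP : μ ^ 4 * (1 - μ ^ 2 * ‖y‖ ^ 2) ^ 2 * luscherPotential y ≤ gnPot μ y := gnPot_ge μ (by linarith)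
    have hV := luscherPotential_nonneg y
    have h1a : 0 ≤ 1 - a := by linarith
    have h1y : 1 - a ≤ 1 - μ ^ 2 * ‖y‖ ^ 2 := by linarith
    have hP' : μ ^ 4 * (1 - a) ^ 2 * luscherPotential y ≤ gnPot μ y :=
      le_trans (mul_le_mul_of_nonneg_right (mul_le_mul_of_nonneg_left (pow_le_pow_left₀ h1a h1y 2) (by positivity)) hV) hP
    have hcomb : 1 - 8 * a ≤ (1 - 6 * a) * (1 - a) ^ 2 := one_sub_eight_mul_le hwin
    have hρ0 : 0 ≤ ρ₀ := by positivity
    have h6 : 0 ≤ 1 - 6 * a := by linarith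
    calc ρ₀ * (8 * B * μ ^ 4) * (1 - 8 * a) * (luscherPotential y * G y ^ 2)
        ≤ ρ₀ * (8 * B * μ ^ 4) * ((1 - 6 * a) * (1 - a) ^ 2) * (luscherPotential y * G y ^ 2) := by
          gcongr
      _ = (ρ₀ * (1 - 6 * a)) * (B * (8 * (μ ^ 4 * (1 - a) ^ 2 * luscherPotential y)) * G y ^ 2) := by ring
      _ ≤ gnDensityReal μ y * (B * (8 * (μ ^ 4 * (1 - a) ^ 2 * luscherPotential y)) * G y ^ 2) :=
          mul_le_mul_of_nonneg_right hρ (by positivity)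
      _ ≤ gnDensityReal μ y * (B * (8 * gnPot μ y) * G y ^ 2) := by
          refine mul_le_mul_of_nonneg_left ?_ (gnDensityReal_pos hμ y).le
          exact mul_le_mul_of_nonneg_right (mul_le_mul_of_nonneg_left (by linarith) hB) (sq_nonneg _)
  -- integrability of the flat integrand: bounded function times the integrable density
  have hHb : ∀ y, |B * (8 * gnPot μ y) * G y ^ 2| ≤ B * Smax * C ^ 2 := by
    intro y
    have h := hb.choose_spec
    have e : B * (8 * gnPot μ y) * G y ^ 2 = B * wilsonAction su2Rep (gnChart μ (fun _ => false) y) * g (gnChart μ (fun _ => false) y) ^ 2 := by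
      rw [wilsonAction_gnChart, hrep]
    rw [e, abs_mul, abs_mul, abs_of_nonneg hB, abs_of_nonneg (wilsonAction_su2_nonneg _), abs_pow]
    exact mul_le_mul (mul_le_mul_of_nonneg_left (wilsonAction_su2_le _) hB) (pow_le_pow_left₀ (abs_nonneg _) (hC _) 2)
      (by positivity) (by positivity)
  have hHm : Measurable fun y => B * (8 * gnPot μ y) * G y ^ 2 := by
    have : (fun y => B * (8 * gnPot μ y) * G y ^ 2) = fun y => (fun U : Cfg => B * wilsonAction su2Rep U * g U ^ 2) (gnChart μ (fun _ => false) y) := by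
      funext y; rw [hrep']
    rw [this]; exact hm.comp (measurable_gnChart μ _)
  have hIr : Integrable fun y => gnDensityReal μ y * (B * (8 * gnPot μ y) * G y ^ 2) := by
    refine ((integrable_gnDensityReal hμ).mul_const (B * Smax * C ^ 2)).mono' ((measurable_gnDensityReal μ).mul hHm).aestronglyMeasurable
      (ae_of_all _ fun y => ?_)
    rw [Real.norm_eq_abs, abs_mul, abs_of_nonneg (gnDensityReal_pos hμ y).le]
    exact mul_le_mul_of_nonneg_left (hHb y) (gnDensityReal_pos hμ y).le
  have hIl : Integrable fun y => ρ₀ * (8 * B * μ ^ 4) * (1 - 8 * a) * (luscherPotential y * G y ^ 2) := hVi.const_mul _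
  have hmono := integral_mono hIl hIr hpt
  rw [integral_const_mul] at hmono
  calc 8 * ρ₀ * (8 * B * μ ^ 4) * (1 - 8 * a) * ∫ y, luscherPotential y * G y ^ 2
      = 8 * (ρ₀ * (8 * B * μ ^ 4) * (1 - 8 * a) * ∫ y, luscherPotential y * G y ^ 2) := by ring
    _ ≤ 8 * ∫ y, gnDensityReal μ y * (B * (8 * gnPot μ y) * G y ^ 2) := by linarith

end Magnetic

end Summit.QuantumFields.YangMills.Theorems.FemtoTransferGap

end
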